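import Literature.Geometry.Lorentzian.KerrHyperboloidalLeaves
import HarnessLib

/-!
# The Kerr–Schild null congruence: straight null lines, geodesy, expansion `2r/Σ`, and the
# divergence `∑_μ ∂_μ g^{μν} = −(2M/Σ) ℓ^ν` of the inverse Kerr metric

(family `gr`; infrastructure for the wave operator `□_g = ∑_μ ∂_μ (g^{μν} ∂_ν)` of
`KerrSchildCoord.lean` in ingoing Kerr–Schild coordinates; namespace `Literature.Geometry.Lorentzian.Kerr`)

`KerrSchildCoord.lean` proves the divergence form `□_g ψ = ∑_μ ∂_μ(∑_ν g^{μν} ∂_ν Φ)` of the wave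
operator of the Kerr metric `g = η + 2H ℓ ⊗ ℓ` (`det g = −1`) and names the first-order coefficients
`c^ν = ∑_μ ∂_μ g^{μν}` (`Kerr.divInverseMetric`) without computing them. This file computes them:

* **straight null lines.** The Kerr–Schild radius grows at unit rate along `ℓ♯`:
  `r(x + s ℓ♯ₓ) = r(x) + s` for `r(x) + s > 0` (`radius_add_smul_nullVector`), and the null covector is
  constant along these lines, `ℓ(x + s ℓ♯ₓ) = ℓ(x)` (`nullCovectorFun_add_smul_nullVector`): the
  principal null congruence of Kerr consists of straight lines of the flat background (Kerr–Schild
  1965, §2: the congruence `ℓ` is geodesic and shear-free for both `η` and `g`); hence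
  `∂_{ℓ♯} r = 1` (`fderiv_radius_nullVector`) and **geodesy** `∂_{ℓ♯} ℓ_μ = 0`
  (`fderiv_nullCovectorFun_nullVector`);
* `∂_{ℓ♯} H = M (Σ − 2r²)/Σ²` for `H = M r/Σ`, `Σ = r² + a² z²/r²` (`fderiv_scalarH_nullVector`);
* the **expansion** of the congruence in the flat coordinates, `∑_μ ∂_μ ℓ^μ = 2r/Σ`
  (`sum_fderiv_nullVector_basisVector`; twice the optical expansion `r/Σ = −Re ρ_NP` of the Kerr
  congruence, Visser arXiv:0706.0622, §5);
* consequently **`c^ν = ∑_μ ∂_μ g^{μν} = −2 (∂_{ℓ♯}H + H ∑_μ ∂_μ ℓ^μ) ℓ^ν = −(2M/Σ) ℓ^ν`**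
  (`divInverseMetric_eq`), valid for all real `M, a` at every point with `r > 0`; e.g. for
  Schwarzschild (`a = 0`) `c = −(2M/r²)(−1, x⃗/r)`.

The last identity is the input for restricting `□_g` to the horizon (Aretakis's conservation law,
`Literature/Barriers/FinalStateConjecture/ExtremalHorizonChargeConservation.lean`) and for the
equivariance of `□_g` under the axial rotations of the chart.

## References

* R. P. Kerr, A. Schild, *A new class of vacuum solutions of the Einstein field equations*, 1965,
  §2 (key `KerrSchild1965`).
* M. Visser, *The Kerr spacetime: a brief introduction*, arXiv:0706.0622, (32)–(35) and §5
  (key `arXiv07060622`).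
-/

noncomputable section

open Set Filter
open scoped Topology

namespace Literature.Geometry.Lorentzian.Kerr

/-! ### The radius as a function on `E4`: gradient and the functions `Σ`, `H = Mr/Σ` -/

/-- The Kerr–Schild radius depends only on the spatial part: `r(x) = r(0, x⃗)`. [folklore] -/
theorem radius_ofTimeSpace_spatial (a : ℝ) (x : E4) :
    radius a (E4.ofTimeSpace 0 (E4.spatial x)) = radius a x := by
  conv_rhs => rw [← E4.ofTimeSpace_time_spatial x]
  exact (radius_ofTimeSpace a (E4.time x) (E4.spatial x)).symm

/-- `x⃗ ₂ = x 3` (the `z`-coordinate). [folklore] -/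
theorem spatial_apply_two (x : E4) : E4.spatial x 2 = x 3 := rfl

/-- **The gradient of the Kerr–Schild radius on `E4`**: `dr_x(v) = ⟨∇r(x⃗), v⃗⟩` with
`∇r = (r² y + a² z e_z)/(rΣ)` (`radiusGrad`), wherever `r > 0`. Visser arXiv:0706.0622, (35).
[cite: arXiv07060622, (35)] -/
theorem hasFDerivAt_radius {a : ℝ} {x : E4} (hx : 0 < radius a x) :
    HasFDerivAt (radius a) ((radiusGrad a (E4.spatial x)).comp E4.spatial) x := by
  have hr : 0 < radius a (E4.ofTimeSpace 0 (E4.spatial x)) := by rwa [radius_ofTimeSpace_spatial]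
  have h := (hasFDerivAt_radius_slice hr).comp x E4.spatial.hasFDerivAt
  refine h.congr_of_eventuallyEq (Eventually.of_forall fun y ↦ ?_)
  exact (radius_ofTimeSpace_spatial a y).symm

/-- `r² Σ = r⁴ + a² z²` on `E4` (`Σ = blSigma a x⃗ = 2r² − ‖x⃗‖² + a²`). Visser arXiv:0706.0622,
(33)–(35). [cite: arXiv07060622, (33)–(35)] -/
theorem sq_mul_blSigma_spatial (a : ℝ) (x : E4) :
    radius a x ^ 2 * blSigma a (E4.spatial x) = radius a x ^ 4 + a ^ 2 * x 3 ^ 2 := by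
  have h := sq_mul_blSigma a (E4.spatial x)
  rwa [radius_ofTimeSpace_spatial, spatial_apply_two] at h

/-- `Σ = 2r² − ‖x⃗‖² + a²` unfolded on `E4`. [folklore] -/
theorem blSigma_spatial_eq (a : ℝ) (x : E4) :
    blSigma a (E4.spatial x) = 2 * radius a x ^ 2 - E4.spatialNorm x ^ 2 + a ^ 2 := by
  rw [blSigma, radius_ofTimeSpace_spatial]
  rfl

/-- `Σ > 0` wherever `r > 0`. [folklore] -/
theorem blSigma_spatial_pos {a : ℝ} {x : E4} (hx : 0 < radius a x) :
    0 < blSigma a (E4.spatial x) :=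
  blSigma_pos (by rwa [radius_ofTimeSpace_spatial])

/-- `H = M r/Σ` on `E4` wherever `r > 0`. Visser arXiv:0706.0622, (33). [cite: arXiv07060622, (33)] -/
theorem scalarH_eq_div_blSigma (M a : ℝ) {x : E4} (hx : 0 < radius a x) :
    scalarH M a x = M * radius a x / blSigma a (E4.spatial x) := by
  have hr : 0 < radius a (E4.ofTimeSpace 0 (E4.spatial x)) := by rwa [radius_ofTimeSpace_spatial]
  have h := scalarH_ofTimeSpace_eq (M := M) (E4.time x) hr
  rwa [E4.ofTimeSpace_time_spatial, radius_ofTimeSpace_spatial] at h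

/-! ### Straight null lines: `r(x + sℓ♯) = r(x) + s` and `ℓ(x + sℓ♯) = ℓ(x)` -/

/-- **Characterisation of the Kerr–Schild radius**: a *positive* root `ρ` of the defining quartic
`ρ⁴ − (‖x⃗‖² − a²)ρ² − a² z² = 0` is the radius (the quadratic in `ρ²` has exactly one positive
root, the product of its roots being `−a²z² ≤ 0`). Visser arXiv:0706.0622, (35). [cite: arXiv07060622, (35)] -/
theorem radius_eq_of_pos_of_quartic {a : ℝ} {x : E4} {ρ : ℝ} (hρ : 0 < ρ)
    (h : ρ ^ 4 - (E4.spatialNorm x ^ 2 - a ^ 2) * ρ ^ 2 - a ^ 2 * x 3 ^ 2 = 0) :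
    radius a x = ρ := by
  set A : ℝ := E4.spatialNorm x ^ 2 - a ^ 2 with hA
  set u : ℝ := ρ ^ 2 with hu
  have hu0 : 0 < u := by positivity
  have hquad : u ^ 2 - A * u - a ^ 2 * x 3 ^ 2 = 0 := by rw [hu]; linear_combination h
  have hAu : A ≤ u := by
    by_contra hlt
    have : u ^ 2 < A * u := by nlinarith
    nlinarith [sq_nonneg (a * x 3)]
  have hsqrt : √(A ^ 2 + 4 * a ^ 2 * x 3 ^ 2) = 2 * u - A := by
    rw [← Real.sqrt_sq (show 0 ≤ 2 * u - A by linarith)]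
    congr 1
    linear_combination (-4 : ℝ) * hquad
  have hr2 : radius a x ^ 2 = u := by
    rw [radius_sq, ← hA, hsqrt]
    ring
  have hr := radius_nonneg a x
  rw [hu] at hr2
  nlinarith [sq_nonneg (radius a x - ρ), sq_nonneg (radius a x + ρ)]

/-- The spatial dot product `x⃗ · ℓ⃗ = r` on `E4` (`inner_nullSpatial_self`). Visser
arXiv:0706.0622, (34)–(35). [cite: arXiv07060622, (34)–(35)] -/
theorem sum_coord_mul_nullCovectorFun {a : ℝ} {x : E4} (hx : 0 < radius a x) :
    x 1 * nullCovectorFun a x 1 + x 2 * nullCovectorFun a x 2 + x 3 * nullCovectorFun a x 3 =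
      radius a x := by
  have hr : 0 < radius a (E4.ofTimeSpace 0 (E4.spatial x)) := by rwa [radius_ofTimeSpace_spatial]
  have h := inner_nullSpatial_self (a := a) (E4.time x) hr
  rw [E4.ofTimeSpace_time_spatial, radius_ofTimeSpace_spatial] at h
  rw [← h]
  simp only [EuclideanSpace.inner_eq_star_dotProduct, star_trivial, dotProduct,
    Fin.sum_univ_three, nullSpatial_apply, Fin.succ_zero_eq_one, Fin.succ_one_eq_two,
    fin_succ_two_eq_three, E4.spatial_apply, Fin.isValue]

/-- `ℓ₀ = 1`. [cite: arXiv07060622, (34)] -/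
@[simp]
theorem nullCovectorFun_apply_zero (a : ℝ) (x : E4) : nullCovectorFun a x 0 = 1 := by
  simp [nullCovectorFun]

/-- `ℓ₁ = (r x + a y)/(r² + a²)`. [cite: arXiv07060622, (34)] -/
theorem nullCovectorFun_apply_one (a : ℝ) (x : E4) :
    nullCovectorFun a x 1 = (radius a x * x 1 + a * x 2) / (radius a x ^ 2 + a ^ 2) := by
  simp [nullCovectorFun]

/-- `ℓ₂ = (r y − a x)/(r² + a²)`. [cite: arXiv07060622, (34)] -/
theorem nullCovectorFun_apply_two (a : ℝ) (x : E4) :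
    nullCovectorFun a x 2 = (radius a x * x 2 - a * x 1) / (radius a x ^ 2 + a ^ 2) := by
  simp [nullCovectorFun]

/-- `ℓ₃ = z/r`. [cite: arXiv07060622, (34)] -/
theorem nullCovectorFun_apply_three (a : ℝ) (x : E4) :
    nullCovectorFun a x 3 = x 3 / radius a x := by
  simp [nullCovectorFun]

/-- Components of the point `x + s ℓ♯ₓ`: time `x⁰ − s`, space `xⁱ + s ℓᵢ`. [folklore] -/
theorem add_smul_nullVector_apply (a : ℝ) (x : E4) (s : ℝ) (μ : Fin 4) :
    (x + s • nullVector a x) μ = x μ + s * nullVector a x μ := by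
  simp

/-- `‖(x + sℓ♯)⃗‖² = ‖x⃗‖² + 2sr + s²` (`x⃗·ℓ⃗ = r`, `|ℓ⃗| = 1`). [cite: arXiv07060622, (34)–(35)] -/
theorem spatialNorm_sq_add_smul_nullVector {a : ℝ} {x : E4} (hx : 0 < radius a x) (s : ℝ) :
    E4.spatialNorm (x + s • nullVector a x) ^ 2 =
      E4.spatialNorm x ^ 2 + 2 * s * radius a x + s ^ 2 := by
  have h1 := sum_coord_mul_nullCovectorFun hx
  have h2 := sum_sq_nullCovectorFun hx
  rw [E4.spatialNorm_sq, E4.spatialNorm_sq]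
  simp only [add_smul_nullVector_apply, nullVector_apply_one, nullVector_apply_two,
    nullVector_apply_three]
  linear_combination (2 * s) * h1 + s ^ 2 * h2

/-- **The Kerr–Schild radius grows at unit rate along the null lines**:
`r(x + s ℓ♯ₓ) = r(x) + s` whenever `r(x) + s > 0` (verify the quartic at `ρ = r + s` using
`x⃗·ℓ⃗ = r`, `|ℓ⃗| = 1`, `ℓ₃ = z/r`, and the uniqueness of the positive root). Kerr–Schild 1965, §2
(the congruence is geodesic in the flat background); Visser arXiv:0706.0622, §5.
[cite: KerrSchild1965, §2] -/
theorem radius_add_smul_nullVector {a : ℝ} {x : E4} (hx : 0 < radius a x) {s : ℝ}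
    (hs : 0 < radius a x + s) :
    radius a (x + s • nullVector a x) = radius a x + s := by
  refine radius_eq_of_pos_of_quartic hs ?_
  rw [spatialNorm_sq_add_smul_nullVector hx s, add_smul_nullVector_apply, nullVector_apply_three,
    nullCovectorFun_apply_three]
  have hq := radius_quartic a x
  have hr0 : radius a x ≠ 0 := hx.ne'
  field_simp
  linear_combination (radius a x ^ 2 + 2 * radius a x * s + s ^ 2) * hq

/-- **The null covector is constant along the null lines**: `ℓ_μ(x + s ℓ♯ₓ) = ℓ_μ(x)` for
`r(x) + s > 0` — the principal null congruence of the Kerr–Schild form consists of straight lines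
of the flat coordinates. Kerr–Schild 1965, §2. [cite: KerrSchild1965, §2] -/
theorem nullCovectorFun_add_smul_nullVector {a : ℝ} {x : E4} (hx : 0 < radius a x) {s : ℝ}
    (hs : 0 < radius a x + s) (μ : Fin 4) :
    nullCovectorFun a (x + s • nullVector a x) μ = nullCovectorFun a x μ := by
  have hrs := radius_add_smul_nullVector hx hs
  have hr0 : radius a x ≠ 0 := hx.ne'
  have hrs0 : radius a x + s ≠ 0 := hs.ne'
  have hQ : radius a x ^ 2 + a ^ 2 ≠ 0 := by positivity
  have hQs : (radius a x + s) ^ 2 + a ^ 2 ≠ 0 := by positivity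
  fin_cases μ
  · simp
  · show nullCovectorFun a (x + s • nullVector a x) 1 = nullCovectorFun a x 1
    rw [nullCovectorFun_apply_one, hrs, add_smul_nullVector_apply, add_smul_nullVector_apply,
      nullVector_apply_one, nullVector_apply_two, nullCovectorFun_apply_one,
      nullCovectorFun_apply_two]
    field_simp
    ring
  · show nullCovectorFun a (x + s • nullVector a x) 2 = nullCovectorFun a x 2
    rw [nullCovectorFun_apply_two, hrs, add_smul_nullVector_apply, add_smul_nullVector_apply,
      nullVector_apply_one, nullVector_apply_two, nullCovectorFun_apply_one,
      nullCovectorFun_apply_two]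
    field_simp
    ring
  · show nullCovectorFun a (x + s • nullVector a x) 3 = nullCovectorFun a x 3
    rw [nullCovectorFun_apply_three, hrs, add_smul_nullVector_apply, nullVector_apply_three,
      nullCovectorFun_apply_three]
    field_simp

/-- The null vector `ℓ♯` is likewise constant along the null lines. [cite: KerrSchild1965, §2] -/
theorem nullVector_add_smul_nullVector {a : ℝ} {x : E4} (hx : 0 < radius a x) {s : ℝ}
    (hs : 0 < radius a x + s) :
    nullVector a (x + s • nullVector a x) = nullVector a x := by
  ext μ
  rw [nullVector_apply, nullVector_apply, nullCovectorFun_add_smul_nullVector hx hs]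

/-- Near `s = 0` the points `x + s ℓ♯ₓ` have `r(x) + s > 0`. [folklore] -/
theorem eventually_radius_add_pos {a : ℝ} {x : E4} (hx : 0 < radius a x) :
    ∀ᶠ s : ℝ in 𝓝 0, 0 < radius a x + s :=
  continuousAt_const.eventually_lt (continuous_const.add continuous_id).continuousAt
    (by simpa using hx)

/-! ### Derivatives along `ℓ♯`: `∂_{ℓ♯} r = 1`, geodesy `∂_{ℓ♯} ℓ = 0`, and `∂_{ℓ♯} H` -/

/-- **`dr(ℓ♯) = 1`**: the radius grows at unit rate along the null lines. Visser arXiv:0706.0622,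
(34)–(35) (`ℓ⃗·∇r = 1`, `radiusGrad_nullSpatial`). [cite: arXiv07060622, (34)–(35)] -/
theorem fderiv_radius_nullVector {a : ℝ} {x : E4} (hx : 0 < radius a x) :
    fderiv ℝ (radius a) x (nullVector a x) = 1 := by
  have hd : DifferentiableAt ℝ (radius a) x :=
    (contDiffAt_radius hx (n := 1)).differentiableAt one_ne_zero
  have h1 : HasLineDerivAt ℝ (radius a) (fderiv ℝ (radius a) x (nullVector a x)) x
      (nullVector a x) := hd.hasFDerivAt.hasLineDerivAt _
  have h2 : HasLineDerivAt ℝ (radius a) 1 x (nullVector a x) := by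
    have hev : (fun s : ℝ ↦ radius a (x + s • nullVector a x)) =ᶠ[𝓝 0]
        fun s ↦ radius a x + s := by
      filter_upwards [eventually_radius_add_pos hx] with s hs
      exact radius_add_smul_nullVector hx hs
    show HasDerivAt (fun s : ℝ ↦ radius a (x + s • nullVector a x)) 1 0
    exact ((hasDerivAt_id (0 : ℝ)).const_add (radius a x)).congr_of_eventuallyEq hev
  exact h1.unique h2

/-- **Geodesy of the null congruence in the flat coordinates**: `∂_{ℓ♯} ℓ_μ = 0` (the covector is
constant along the null lines). Kerr–Schild 1965, §2. [cite: KerrSchild1965, §2] -/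
theorem fderiv_nullCovectorFun_nullVector {a : ℝ} {x : E4} (hx : 0 < radius a x) (μ : Fin 4) :
    fderiv ℝ (fun y ↦ nullCovectorFun a y μ) x (nullVector a x) = 0 := by
  have hd : DifferentiableAt ℝ (fun y ↦ nullCovectorFun a y μ) x :=
    (contDiffAt_nullCovectorFun a hx (n := 1) μ).differentiableAt one_ne_zero
  have h1 : HasLineDerivAt ℝ (fun y ↦ nullCovectorFun a y μ)
      (fderiv ℝ (fun y ↦ nullCovectorFun a y μ) x (nullVector a x)) x (nullVector a x) :=
    hd.hasFDerivAt.hasLineDerivAt _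
  have h2 : HasLineDerivAt ℝ (fun y ↦ nullCovectorFun a y μ) 0 x (nullVector a x) := by
    have hev : (fun s : ℝ ↦ nullCovectorFun a (x + s • nullVector a x) μ) =ᶠ[𝓝 0]
        fun _ ↦ nullCovectorFun a x μ := by
      filter_upwards [eventually_radius_add_pos hx] with s hs
      exact nullCovectorFun_add_smul_nullVector hx hs μ
    show HasDerivAt (fun s : ℝ ↦ nullCovectorFun a (x + s • nullVector a x) μ) 0 0
    exact (hasDerivAt_const (0 : ℝ) (nullCovectorFun a x μ)).congr_of_eventuallyEq hev
  exact h1.unique h2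

/-- `∂_{ℓ♯} (ℓ♯)^μ = 0` (components of `ℓ♯` are `±ℓ_μ`). [cite: KerrSchild1965, §2] -/
theorem fderiv_nullVector_apply_nullVector {a : ℝ} {x : E4} (hx : 0 < radius a x) (μ : Fin 4) :
    fderiv ℝ (fun y ↦ nullVector a y μ) x (nullVector a x) = 0 := by
  have hfun : (fun y ↦ nullVector a y μ) =
      fun y ↦ (if μ = 0 then -1 else 1) * nullCovectorFun a y μ := by
    funext y; exact nullVector_apply a y μ
  have hd : DifferentiableAt ℝ (fun y ↦ nullCovectorFun a y μ) x :=
    (contDiffAt_nullCovectorFun a hx (n := 1) μ).differentiableAt one_ne_zero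
  rw [hfun, fderiv_const_mul hd]
  split_ifs <;> simp [fderiv_nullCovectorFun_nullVector hx]

/-- Along the null lines `Σ(x + sℓ♯) = Σ(x) + 2 r s + s²`. [folklore] -/
theorem blSigma_spatial_add_smul_nullVector {a : ℝ} {x : E4} (hx : 0 < radius a x) {s : ℝ}
    (hs : 0 < radius a x + s) :
    blSigma a (E4.spatial (x + s • nullVector a x)) =
      blSigma a (E4.spatial x) + 2 * radius a x * s + s ^ 2 := by
  rw [blSigma_spatial_eq, blSigma_spatial_eq, radius_add_smul_nullVector hx hs,
    spatialNorm_sq_add_smul_nullVector hx]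
  ring

/-- **`∂_{ℓ♯} H = M (Σ − 2r²)/Σ²`** for the Kerr–Schild scalar `H = M r/Σ` (along the null lines
`H(s) = M (r + s)/(Σ + 2rs + s²)`). Kerr–Schild 1965, §2; Visser arXiv:0706.0622, (33).
[cite: arXiv07060622, (33)] -/
theorem fderiv_scalarH_nullVector (M : ℝ) {a : ℝ} {x : E4} (hx : 0 < radius a x) :
    fderiv ℝ (scalarH M a) x (nullVector a x) =
      M * (blSigma a (E4.spatial x) - 2 * radius a x ^ 2) / blSigma a (E4.spatial x) ^ 2 := by
  have hSig := blSigma_spatial_pos hx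
  have hd : DifferentiableAt ℝ (scalarH M a) x :=
    (contDiffAt_scalarH M a hx (n := 1)).differentiableAt one_ne_zero
  have h1 : HasLineDerivAt ℝ (scalarH M a) (fderiv ℝ (scalarH M a) x (nullVector a x)) x
      (nullVector a x) := hd.hasFDerivAt.hasLineDerivAt _
  have h2 : HasLineDerivAt ℝ (scalarH M a)
      (M * (blSigma a (E4.spatial x) - 2 * radius a x ^ 2) / blSigma a (E4.spatial x) ^ 2) x
      (nullVector a x) := by
    have hev : (fun s : ℝ ↦ scalarH M a (x + s • nullVector a x)) =ᶠ[𝓝 0]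
        fun s ↦ M * (radius a x + s) / (blSigma a (E4.spatial x) + 2 * radius a x * s + s ^ 2) := by
      filter_upwards [eventually_radius_add_pos hx] with s hs
      have hxs : 0 < radius a (x + s • nullVector a x) := by
        rwa [radius_add_smul_nullVector hx hs]
      rw [scalarH_eq_div_blSigma M a hxs, radius_add_smul_nullVector hx hs,
        blSigma_spatial_add_smul_nullVector hx hs]
    show HasDerivAt (fun s : ℝ ↦ scalarH M a (x + s • nullVector a x)) _ 0
    have hc : HasDerivAt (fun s : ℝ ↦ M * (radius a x + s)) M 0 := by
      simpa using ((hasDerivAt_id (0 : ℝ)).const_add (radius a x)).const_mul M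
    have hden : HasDerivAt (fun s : ℝ ↦ blSigma a (E4.spatial x) + 2 * radius a x * s + s ^ 2)
        (2 * radius a x) 0 := by
      have h1 : HasDerivAt (fun s : ℝ ↦ blSigma a (E4.spatial x) + 2 * radius a x * s)
          (2 * radius a x) 0 := by
        simpa using ((hasDerivAt_id (0 : ℝ)).const_mul (2 * radius a x)).const_add
          (blSigma a (E4.spatial x))
      have h2 : HasDerivAt (fun s : ℝ ↦ s ^ 2) 0 0 := by simpa using hasDerivAt_pow 2 (0 : ℝ)
      have h := h1.add h2
      rw [add_zero] at h
      exact h.congr_of_eventuallyEq (Eventually.of_forall fun s ↦ rfl)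
    have hdiv := hc.div hden (by simpa using hSig.ne')
    refine (hdiv.congr_of_eventuallyEq hev).congr_deriv ?_
    simp only [add_zero, mul_zero, zero_pow two_ne_zero]
    field_simp
  exact h1.unique h2

/-! ### The expansion of the null congruence: `∑_μ ∂_μ ℓ^μ = 2r/Σ` -/

/-- Components of the point `x + t ∂_i`. [folklore] -/
theorem add_smul_basisVector_apply (x : E4) (t : ℝ) (i j : Fin 4) :
    (x + t • E4.basisVector i) j = x j + if j = i then t else 0 := by
  by_cases h : j = i
  · subst h; simp [E4.basisVector]
  · simp [E4.basisVector, h]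

/-- The radius along a coordinate line has derivative `dr(∂_i)` (a line derivative). [folklore] -/
theorem hasDerivAt_radius_line {a : ℝ} {x : E4} (hx : 0 < radius a x) (v : E4) :
    HasDerivAt (fun t : ℝ ↦ radius a (x + t • v)) (fderiv ℝ (radius a) x v) 0 :=
  ((contDiffAt_radius hx (n := 1)).differentiableAt one_ne_zero).hasFDerivAt.hasLineDerivAt v

/-- **The partial derivatives of the Kerr–Schild radius**: `∂_{i+1} r = (∇r)_i =
(r² xⁱ⁺¹ + δ_{i2} a² z)/(rΣ)`. Visser arXiv:0706.0622, (35). [cite: arXiv07060622, (35)] -/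
theorem fderiv_radius_basisVector_succ {a : ℝ} {x : E4} (hx : 0 < radius a x) (i : Fin 3) :
    fderiv ℝ (radius a) x (E4.basisVector i.succ) =
      (radius a x ^ 2 * x i.succ + if i = 2 then a ^ 2 * x 3 else 0) /
        (radius a x * blSigma a (E4.spatial x)) := by
  rw [(hasFDerivAt_radius hx).fderiv, ContinuousLinearMap.comp_apply, E4.spatial_basisVector_succ,
    radiusGrad_single, radiusGradVec_apply, radius_ofTimeSpace_spatial]
  rfl

/-- `∂₁ ℓ₁ = ((∂₁r · x + r)(r² + a²) − (r x + a y) · 2r ∂₁r)/(r² + a²)²` (quotient rule along the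
coordinate line `t ↦ x + t∂₁`). [cite: arXiv07060622, (34)] -/
theorem fderiv_nullCovectorFun_one_basisVector_one {a : ℝ} {x : E4} (hx : 0 < radius a x) :
    fderiv ℝ (fun y ↦ nullCovectorFun a y 1) x (E4.basisVector 1) =
      ((fderiv ℝ (radius a) x (E4.basisVector 1) * x 1 + radius a x) * (radius a x ^ 2 + a ^ 2) -
        (radius a x * x 1 + a * x 2) * (2 * radius a x * fderiv ℝ (radius a) x (E4.basisVector 1))) /
      (radius a x ^ 2 + a ^ 2) ^ 2 := by
  have hQ : radius a x ^ 2 + a ^ 2 ≠ 0 := by positivity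
  have hd : DifferentiableAt ℝ (fun y ↦ nullCovectorFun a y 1) x :=
    (contDiffAt_nullCovectorFun a hx (n := 1) 1).differentiableAt one_ne_zero
  have h1 : HasLineDerivAt ℝ (fun y ↦ nullCovectorFun a y 1)
      (fderiv ℝ (fun y ↦ nullCovectorFun a y 1) x (E4.basisVector 1)) x (E4.basisVector 1) :=
    hd.hasFDerivAt.hasLineDerivAt _
  refine h1.unique ?_
  show HasDerivAt (fun t : ℝ ↦ nullCovectorFun a (x + t • E4.basisVector 1) 1) _ 0
  have hr := hasDerivAt_radius_line hx (E4.basisVector 1)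
  have hnum : HasDerivAt (fun t : ℝ ↦ radius a (x + t • E4.basisVector 1) * (x 1 + t) + a * x 2)
      (fderiv ℝ (radius a) x (E4.basisVector 1) * (x 1 + 0) +
        radius a (x + (0 : ℝ) • E4.basisVector 1) * 1) 0 :=
    (hr.mul ((hasDerivAt_id (0 : ℝ)).const_add (x 1))).add_const (a * x 2)
  have hden : HasDerivAt (fun t : ℝ ↦ radius a (x + t • E4.basisVector 1) ^ 2 + a ^ 2)
      (↑(2 : ℕ) * radius a (x + (0 : ℝ) • E4.basisVector 1) ^ (2 - 1) *
        fderiv ℝ (radius a) x (E4.basisVector 1)) 0 :=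
    (hr.pow 2).add_const (a ^ 2)
  have hdiv := hnum.div hden (by simpa using hQ)
  have hfun : (fun t : ℝ ↦ nullCovectorFun a (x + t • E4.basisVector 1) 1) = fun t ↦
      (radius a (x + t • E4.basisVector 1) * (x 1 + t) + a * x 2) /
        (radius a (x + t • E4.basisVector 1) ^ 2 + a ^ 2) := by
    funext t
    rw [nullCovectorFun_apply_one, add_smul_basisVector_apply, add_smul_basisVector_apply]
    simp
  rw [hfun]
  refine hdiv.congr_deriv ?_
  simp only [zero_smul, add_zero, Nat.cast_ofNat, mul_one, pow_one, Nat.add_one_sub_one]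

/-- `∂₂ ℓ₂ = ((∂₂r · y + r)(r² + a²) − (r y − a x) · 2r ∂₂r)/(r² + a²)²`. [cite: arXiv07060622, (34)] -/
theorem fderiv_nullCovectorFun_two_basisVector_two {a : ℝ} {x : E4} (hx : 0 < radius a x) :
    fderiv ℝ (fun y ↦ nullCovectorFun a y 2) x (E4.basisVector 2) =
      ((fderiv ℝ (radius a) x (E4.basisVector 2) * x 2 + radius a x) * (radius a x ^ 2 + a ^ 2) -
        (radius a x * x 2 - a * x 1) * (2 * radius a x * fderiv ℝ (radius a) x (E4.basisVector 2))) /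
      (radius a x ^ 2 + a ^ 2) ^ 2 := by
  have hQ : radius a x ^ 2 + a ^ 2 ≠ 0 := by positivity
  have hd : DifferentiableAt ℝ (fun y ↦ nullCovectorFun a y 2) x :=
    (contDiffAt_nullCovectorFun a hx (n := 1) 2).differentiableAt one_ne_zero
  have h1 : HasLineDerivAt ℝ (fun y ↦ nullCovectorFun a y 2)
      (fderiv ℝ (fun y ↦ nullCovectorFun a y 2) x (E4.basisVector 2)) x (E4.basisVector 2) :=
    hd.hasFDerivAt.hasLineDerivAt _
  refine h1.unique ?_
  show HasDerivAt (fun t : ℝ ↦ nullCovectorFun a (x + t • E4.basisVector 2) 2) _ 0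
  have hr := hasDerivAt_radius_line hx (E4.basisVector 2)
  have hnum : HasDerivAt (fun t : ℝ ↦ radius a (x + t • E4.basisVector 2) * (x 2 + t) - a * x 1)
      (fderiv ℝ (radius a) x (E4.basisVector 2) * (x 2 + 0) +
        radius a (x + (0 : ℝ) • E4.basisVector 2) * 1) 0 :=
    (hr.mul ((hasDerivAt_id (0 : ℝ)).const_add (x 2))).sub_const (a * x 1)
  have hden : HasDerivAt (fun t : ℝ ↦ radius a (x + t • E4.basisVector 2) ^ 2 + a ^ 2)
      (↑(2 : ℕ) * radius a (x + (0 : ℝ) • E4.basisVector 2) ^ (2 - 1) *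
        fderiv ℝ (radius a) x (E4.basisVector 2)) 0 :=
    (hr.pow 2).add_const (a ^ 2)
  have hdiv := hnum.div hden (by simpa using hQ)
  have hfun : (fun t : ℝ ↦ nullCovectorFun a (x + t • E4.basisVector 2) 2) = fun t ↦
      (radius a (x + t • E4.basisVector 2) * (x 2 + t) - a * x 1) /
        (radius a (x + t • E4.basisVector 2) ^ 2 + a ^ 2) := by
    funext t
    rw [nullCovectorFun_apply_two, add_smul_basisVector_apply, add_smul_basisVector_apply]
    simp
  rw [hfun]
  refine hdiv.congr_deriv ?_
  simp only [zero_smul, add_zero, Nat.cast_ofNat, mul_one, pow_one, Nat.add_one_sub_one]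

/-- `∂₃ ℓ₃ = (r − z ∂₃r)/r²`. [cite: arXiv07060622, (34)] -/
theorem fderiv_nullCovectorFun_three_basisVector_three {a : ℝ} {x : E4} (hx : 0 < radius a x) :
    fderiv ℝ (fun y ↦ nullCovectorFun a y 3) x (E4.basisVector 3) =
      (radius a x - x 3 * fderiv ℝ (radius a) x (E4.basisVector 3)) / radius a x ^ 2 := by
  have hd : DifferentiableAt ℝ (fun y ↦ nullCovectorFun a y 3) x :=
    (contDiffAt_nullCovectorFun a hx (n := 1) 3).differentiableAt one_ne_zero
  have h1 : HasLineDerivAt ℝ (fun y ↦ nullCovectorFun a y 3)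
      (fderiv ℝ (fun y ↦ nullCovectorFun a y 3) x (E4.basisVector 3)) x (E4.basisVector 3) :=
    hd.hasFDerivAt.hasLineDerivAt _
  refine h1.unique ?_
  show HasDerivAt (fun t : ℝ ↦ nullCovectorFun a (x + t • E4.basisVector 3) 3) _ 0
  have hr := hasDerivAt_radius_line hx (E4.basisVector 3)
  have hnum : HasDerivAt (fun t : ℝ ↦ x 3 + t) 1 0 := (hasDerivAt_id (0 : ℝ)).const_add (x 3)
  have hdiv := hnum.div hr (by simpa using hx.ne')
  have hfun : (fun t : ℝ ↦ nullCovectorFun a (x + t • E4.basisVector 3) 3) = fun t ↦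
      (x 3 + t) / radius a (x + t • E4.basisVector 3) := by
    funext t
    rw [nullCovectorFun_apply_three, add_smul_basisVector_apply]
    simp
  rw [hfun]
  refine hdiv.congr_deriv ?_
  simp only [zero_smul, add_zero, one_mul]

/-- `∂₁ r = r x/Σ` (`fderiv_radius_basisVector_succ`, `i = 0`). [cite: arXiv07060622, (35)] -/
theorem fderiv_radius_basisVector_one {a : ℝ} {x : E4} (hx : 0 < radius a x) :
    fderiv ℝ (radius a) x (E4.basisVector 1) =
      radius a x ^ 2 * x 1 / (radius a x * blSigma a (E4.spatial x)) := by
  have h := fderiv_radius_basisVector_succ hx 0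
  simpa using h

/-- `∂₂ r = r y/Σ`. [cite: arXiv07060622, (35)] -/
theorem fderiv_radius_basisVector_two {a : ℝ} {x : E4} (hx : 0 < radius a x) :
    fderiv ℝ (radius a) x (E4.basisVector 2) =
      radius a x ^ 2 * x 2 / (radius a x * blSigma a (E4.spatial x)) := by
  have h := fderiv_radius_basisVector_succ hx 1
  simpa using h

/-- `∂₃ r = (r² + a²) z/(rΣ)`. [cite: arXiv07060622, (35)] -/
theorem fderiv_radius_basisVector_three {a : ℝ} {x : E4} (hx : 0 < radius a x) :
    fderiv ℝ (radius a) x (E4.basisVector 3) =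
      (radius a x ^ 2 * x 3 + a ^ 2 * x 3) / (radius a x * blSigma a (E4.spatial x)) := by
  have h := fderiv_radius_basisVector_succ hx 2
  simpa using h

/-- The polynomial identity behind `∑ ∂_μ ℓ^μ = 2r/Σ`: with `r²Σ = r⁴ + a²z²` and
`Σ = 2r² − |x⃗|² + a²` the three diagonal partials sum to `2r/Σ`. [folklore] -/
theorem divergence_alg (r X Y Z a S : ℝ) (hr : r ≠ 0) (hS : S ≠ 0) (hQ : r ^ 2 + a ^ 2 ≠ 0)
    (h1 : r ^ 2 * S = r ^ 4 + a ^ 2 * Z ^ 2)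
    (h2 : S = 2 * r ^ 2 - (X ^ 2 + Y ^ 2 + Z ^ 2) + a ^ 2) :
    ((r ^ 2 * X / (r * S) * X + r) * (r ^ 2 + a ^ 2) -
        (r * X + a * Y) * (2 * r * (r ^ 2 * X / (r * S)))) / (r ^ 2 + a ^ 2) ^ 2 +
      ((r ^ 2 * Y / (r * S) * Y + r) * (r ^ 2 + a ^ 2) -
        (r * Y - a * X) * (2 * r * (r ^ 2 * Y / (r * S)))) / (r ^ 2 + a ^ 2) ^ 2 +
      (r - Z * ((r ^ 2 * Z + a ^ 2 * Z) / (r * S))) / r ^ 2 = 2 * r / S := by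
  field_simp
  linear_combination (r ^ 4 * (a ^ 2 - r ^ 2)) * h2 + (4 * r ^ 4 + 3 * a ^ 2 * r ^ 2 + a ^ 4) * h1

/-- **The expansion of the Kerr–Schild null congruence in the flat coordinates**:
`∑_μ ∂_μ (ℓ♯)^μ = ∂₁ℓ₁ + ∂₂ℓ₂ + ∂₃ℓ₃ = 2r/Σ` wherever `r > 0` (twice the optical expansion
`r/Σ` of the shear-free geodesic congruence `ℓ`; for `a = 0`, `div(x⃗/r) = 2/r`). Kerr–Schild
1965, §2; Visser arXiv:0706.0622, §5. [cite: KerrSchild1965, §2] -/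
theorem sum_fderiv_nullVector_basisVector {a : ℝ} {x : E4} (hx : 0 < radius a x) :
    ∑ μ, fderiv ℝ (fun y ↦ nullVector a y μ) x (E4.basisVector μ) =
      2 * radius a x / blSigma a (E4.spatial x) := by
  have hV : ∀ μ, (fun y ↦ nullVector a y μ) =
      fun y ↦ (if μ = 0 then -1 else 1) * nullCovectorFun a y μ :=
    fun μ ↦ funext fun y ↦ nullVector_apply a y μ
  have hd : ∀ μ, DifferentiableAt ℝ (fun y ↦ nullCovectorFun a y μ) x :=
    fun μ ↦ (contDiffAt_nullCovectorFun a hx (n := 1) μ).differentiableAt one_ne_zero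
  have h0 : fderiv ℝ (fun y ↦ nullCovectorFun a y 0) x = 0 := by
    have : (fun y ↦ nullCovectorFun a y 0) = fun _ ↦ (1 : ℝ) :=
      funext fun y ↦ nullCovectorFun_apply_zero a y
    rw [this]
    exact fderiv_const_apply 1
  rw [Fin.sum_univ_four, hV 0, hV 1, hV 2, hV 3, fderiv_const_mul (hd 0), fderiv_const_mul (hd 1),
    fderiv_const_mul (hd 2), fderiv_const_mul (hd 3)]
  simp only [Fin.isValue, ↓reduceIte, one_ne_zero, Fin.reduceEq, neg_smul, one_smul,
    h0, _root_.zero_apply, neg_zero, zero_add,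
    fderiv_nullCovectorFun_one_basisVector_one hx, fderiv_nullCovectorFun_two_basisVector_two hx,
    fderiv_nullCovectorFun_three_basisVector_three hx, fderiv_radius_basisVector_one hx,
    fderiv_radius_basisVector_two hx, fderiv_radius_basisVector_three hx]
  have hq : blSigma a (E4.spatial x) =
      2 * radius a x ^ 2 - (x 1 ^ 2 + x 2 ^ 2 + x 3 ^ 2) + a ^ 2 := by
    rw [blSigma_spatial_eq, E4.spatialNorm_sq]
  exact divergence_alg (radius a x) (x 1) (x 2) (x 3) a (blSigma a (E4.spatial x)) hx.ne'
    (blSigma_spatial_pos hx).ne' (by positivity) (sq_mul_blSigma_spatial a x) hq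

/-! ### The divergence of the inverse metric: `∑_μ ∂_μ g^{μν} = −(2M/Σ) ℓ^ν` -/

/-- Contraction of a linear functional with `ℓ♯` in the coordinate basis:
`∑_μ L(∂_μ) (ℓ♯)^μ = L(ℓ♯)`. [folklore] -/
theorem sum_apply_basisVector_mul_nullVector (L : E4 →L[ℝ] ℝ) (a : ℝ) (x : E4) :
    ∑ μ, L (E4.basisVector μ) * nullVector a x μ = L (nullVector a x) := by
  conv_rhs => rw [eq_sum_basisVector (nullVector a x), map_sum]
  exact Finset.sum_congr rfl fun μ _ ↦ by rw [map_smul, smul_eq_mul, mul_comm]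

/-- **The divergence of the inverse Kerr metric in Kerr–Schild coordinates**:
`c^ν = ∑_μ ∂_μ g^{μν} = −2 (∂_{ℓ♯}H · ℓ^ν + H ∂_{ℓ♯}ℓ^ν + H ℓ^ν ∑_μ ∂_μ ℓ^μ) = −(2M/Σ) ℓ^ν`
for all real `M, a` wherever `r > 0` (`g^{μν} = η^{μν} − 2H ℓ^μ ℓ^ν`, geodesy, `∂_{ℓ♯}H = M(Σ − 2r²)/Σ²`,
expansion `2r/Σ`, `H = Mr/Σ`). These are the first-order coefficients of
`□_g = ∑ ∂_μ(g^{μν} ∂_ν)` (`dalembertian_eq_divergence`), i.e. `□_g Φ = g^{μν} ∂_μ∂_ν Φ − (2M/Σ) ℓ♯(Φ)`.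
Kerr–Schild 1965, §2. [cite: KerrSchild1965, §2] -/
theorem divInverseMetric_eq (M a : ℝ) {x : E4} (hx : 0 < radius a x) (ν : Fin 4) :
    divInverseMetric M a x ν = -(2 * M / blSigma a (E4.spatial x)) * nullVector a x ν := by
  have hSig := blSigma_spatial_pos hx
  unfold divInverseMetric
  have hfun : ∀ μ, (fun y ↦ inverseMetric M a y μ ν) =
      fun y ↦ etaComp μ ν - ((fun y ↦ 2 * scalarH M a y) * (fun y ↦ nullVector a y ν) *
        (fun y ↦ nullVector a y μ)) y := by
    intro μ; funext y; rw [inverseMetric_apply]; simp only [Pi.mul_apply]; rfl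
  have hH : HasFDerivAt (scalarH M a) (fderiv ℝ (scalarH M a) x) x :=
    ((contDiffAt_scalarH M a hx (n := 1)).differentiableAt one_ne_zero).hasFDerivAt
  have hVd : ∀ κ, HasFDerivAt (fun y ↦ nullVector a y κ) (fderiv ℝ (fun y ↦ nullVector a y κ) x) x :=
    fun κ ↦ ((contDiffAt_euclidean.mp (contDiffAt_nullVector a hx (n := 1)) κ).differentiableAt
      one_ne_zero).hasFDerivAt
  have hderiv : ∀ μ, fderiv ℝ (fun y ↦ inverseMetric M a y μ ν) x (E4.basisVector μ) =
      -(2 * (fderiv ℝ (scalarH M a) x (E4.basisVector μ) * nullVector a x μ)) * nullVector a x ν -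
      2 * scalarH M a x * (fderiv ℝ (fun y ↦ nullVector a y ν) x (E4.basisVector μ) *
        nullVector a x μ) -
      2 * scalarH M a x * nullVector a x ν *
        fderiv ℝ (fun y ↦ nullVector a y μ) x (E4.basisVector μ) := by
    intro μ
    rw [hfun μ, ((((hH.const_mul 2).mul (hVd ν)).mul (hVd μ)).const_sub (etaComp μ ν)).fderiv]
    simp [Pi.mul_apply, smul_eq_mul]
    ring
  simp only [hderiv, Finset.sum_sub_distrib, ← Finset.mul_sum, ← Finset.sum_mul,
    Finset.sum_neg_distrib, sum_apply_basisVector_mul_nullVector,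
    fderiv_nullVector_apply_nullVector hx, sum_fderiv_nullVector_basisVector hx,
    fderiv_scalarH_nullVector M hx, scalarH_eq_div_blSigma M a hx]
  field_simp
  ring

end Literature.Geometry.Lorentzian.Kerr

end
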